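import Mathlib.Analysis.Complex.Polynomial.Basic
import Mathlib.FieldTheory.IntermediateField.Algebraic
import Mathlib.FieldTheory.Perfect
import Mathlib.RingTheory.Polynomial.Tower
import HarnessLib

/-!
# MULTI-FIELD WEIL ENGINE — THE QUINTIC DEGREE CHASE: two simple extensions of degree `5` of a subfield `M ⊂ ℂ` such that no conjugate of
# one generator lies in the field generated by a conjugate of the other are LINEARLY DISJOINT (`[M(a, b) : M] = 25`)

Cell `pub-hodgecm2` (COR-CM), seat b30 gen 32 (2026-08-24); count-neutral own lane MULTI-FIELD WEIL ENGINE (stem `MultiFieldWeil*`).  Pure field theory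
(theorems only; no definition, no named fact, no `sorry`); nothing Hodge-theoretic is asserted and `HC_CM` is NOT proved.  Sequel of
`CorCM/MultiFieldWeilNonIsomorphicSextics.lean` (gen 31, the CUBIC case: "a cubic with no root is irreducible") and source of the number-field statement
`finrank_adjoin_pair_of_isEmpty_ringHom_five` and the decic headline of `CorCM/MultiFieldWeilNonIsomorphicDecics.lean`.

THE STATEMENT (§2, **`finrank_adjoin_pair_eq_of_forall_not_mem`**).  `M` a field with `M → ℂ`, `a, b ∈ ℂ` of degree `5` over `M`; assume that for every
conjugate `x` of `a` and every conjugate `y` of `b` over `M`, `y ∉ M(x)`.  Then `[M(a, b) : M] = 25` — the minimal polynomial of `b` over `M` stays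
irreducible over `M(a)`.  For two extensions of the same PRIME degree `ℓ` the hypothesis "no embedding of one into a conjugate of the other" forces linear
disjointness exactly for `ℓ ≤ 5` (for `ℓ = 7` the two inequivalent degree-`7` actions of `PSL₂(𝔽₇)` give non-isomorphic, non-disjoint fields); the usual
proof for `ℓ = 5` quotes the list of transitive quintic groups (`C₅, D₅, F₂₀, A₅, S₅`, each with ONE class of subgroups of index `5`).  The proof here is an
ELEMENTARY DEGREE CHASE on the `5 × 5` conjugates, with no group theory:

* `d(x, y) := [M(x)(y) : M(x)]` is the number of conjugates of `y` over `M(x)` among the `5` conjugates of `b` (§1 `card_filter_minpoly_eq`: the class of `y`);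
  it is SYMMETRIC, `d(x,y) = [M(y)(x) : M(y)]`, by the tower law since `[M(x) : M] = [M(y) : M] = 5` (§2 `natDegree_minpoly_adjoin_symm`);
* `d ≠ 1` (hypothesis); `d ≠ 4` (§1 `natDegree_minpoly_ne_card_sub_one`: the complementary class would be a single conjugate of degree `1`); and ONE value
  `d(x,y) = 5` propagates to all pairs (§1 `natDegree_minpoly_eq_card_of_one`, used on both sides), giving `[M(a,b) : M] = 5 · 5`;
* otherwise `d ∈ {2, 3}` throughout; then every `x` has exactly TWO `y` with `d(x,y) = 2` (§1 `card_filter_natDegree_eq_two`: the `y` of degree `2` come in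
  classes of size `2`, those of degree `3` in classes of size `3`, and `5 = 2i + 3j` forces `i = j = 1`), and symmetrically for every `y`;
* THE CHASE: for an edge `d(x₀, y₀) = 2` the class `{y₀, y₁}` of `y₀` over `M(x₀)` and the class `{x₀, x₁}` of `x₀` over `M(y₀)` both lie in the field
  `M(x₀, y₀)` of degree `10` (§1 `mem_adjoin_of_minpoly_eq_of_natDegree_eq_two`: the second root of a quadratic is `−y₀ −` the middle coefficient), so
  `M(x₁, y₁) ⊆ M(x₀, y₀)` and `5 · d(x₁, y₁) ∣ 10`, whence `d(x₁, y₁) = 2`: the rows of `x₀` and `x₁` coincide, the fibres of `x ↦ row(x)` on the conjugates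
  of `a` are the `2`-element columns, and `5` would be even.

§2 also records the tower law `finrank_adjoin_pair_eq_mul`, `minpoly_eq_of_aeval_minpoly_eq_zero` and the transport lemma
**`exists_root_mem_adjoin_of_root_mem_adjoin_conj`** (a root of `g ∈ M[X]` inside `M(x)`, `x` a conjugate of `a`, is carried to a root of `g` inside `M(a)` by
the `M`-embedding `M(x) → ℂ`, `x ↦ a` — Mathlib `IntermediateField.algHomAdjoinIntegralEquiv`), which reduces the hypothesis to roots avoiding `M(a)` alone.

[cite: Lang2002, V §1 Prop. 1.2, VI §1 Thm. 1.1 and V §2 Thm. 2.8]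

## References
* [Lang2002] S. Lang, *Algebra*, 3rd ed., GTM 211: V §1 Prop. 1.2 (tower law), V §2 Thm. 2.8 (extension of embeddings), VI §1 Thm. 1.1 (the number of
  roots of a separable irreducible polynomial; conjugates and simple extensions).
* [DixonMortimer1996] J. D. Dixon, B. Mortimer, *Permutation Groups*, GTM 163, §1.6 and §3.3 (the transitive groups of prime degree `5` — NOT used here; recorded
  as the classical route this file avoids).
-/

noncomputable section

open IntermediateField Polynomial
open scoped Classical

namespace Summit.HodgeConjecture.CorCM.MultiFieldWeil

/-! ## §1 Roots in `ℂ` and the conjugacy classes of one root over an intermediate field -/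

section OneSide

variable {M : Type*} [Field M] [Algebra M ℂ]

/-- A separable polynomial over a subfield `M → ℂ` has exactly `deg` roots in `ℂ`. [folklore] -/
theorem card_aroots_toFinset_eq_natDegree {g : M[X]} (hsep : g.Separable) : (g.aroots ℂ).toFinset.card = g.natDegree := by
  rw [Multiset.toFinset_card_of_nodup (nodup_roots hsep.map),
    ← (IsAlgClosed.splits (g.map (algebraMap M ℂ))).natDegree_eq_card_roots, natDegree_map]

/-- Membership in the root finset. [folklore] -/
theorem mem_aroots_toFinset_iff {g : M[X]} (hg : g ≠ 0) {y : ℂ} : y ∈ (g.aroots ℂ).toFinset ↔ aeval y g = 0 := by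
  rw [Multiset.mem_toFinset, mem_aroots]
  exact ⟨fun h => h.2, fun h => ⟨hg, h⟩⟩

/-- A complex root of a non-zero polynomial over `M` is integral over every intermediate field `E`. [folklore] -/
theorem isIntegral_of_mem_aroots_toFinset (E : IntermediateField M ℂ) {g : M[X]} (hg : g ≠ 0) {y : ℂ} (hy : y ∈ (g.aroots ℂ).toFinset) :
    IsIntegral E y := by
  have h : IsIntegral M y := isAlgebraic_iff_isIntegral.mp ⟨g, hg, (mem_aroots_toFinset_iff hg).1 hy⟩
  exact h.tower_top

/-- **The class of a root.**  For a root `y ∈ ℂ` of `g ∈ M[X]` and an intermediate field `E`, the roots of `g` with the same minimal polynomial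
over `E` as `y` are exactly the complex roots of that minimal polynomial. [folklore] -/
theorem filter_minpoly_eq_eq_aroots (E : IntermediateField M ℂ) {g : M[X]} (hg : g ≠ 0) {y : ℂ} (hy : y ∈ (g.aroots ℂ).toFinset) :
    (g.aroots ℂ).toFinset.filter (fun y' => minpoly E y' = minpoly E y) = ((minpoly E y).aroots ℂ).toFinset := by
  have hyint : IsIntegral E y := isIntegral_of_mem_aroots_toFinset E hg hy
  ext y'
  rw [Finset.mem_filter, mem_aroots_toFinset_iff (minpoly.ne_zero hyint), mem_aroots_toFinset_iff hg]
  constructor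
  · rintro ⟨-, h⟩
    rw [← h]
    exact minpoly.aeval E y'
  · intro h
    have hdvd : minpoly E y ∣ g.map (algebraMap M E) := minpoly.dvd E y (by rw [aeval_map_algebraMap]; exact (mem_aroots_toFinset_iff hg).1 hy)
    refine ⟨?_, (minpoly.eq_of_irreducible_of_monic (minpoly.irreducible hyint) h (minpoly.monic hyint)).symm⟩
    have h2 := aeval_eq_zero_of_dvd_aeval_eq_zero hdvd h
    rwa [aeval_map_algebraMap] at h2

/-- **The class of a root has as many members as the degree of the minimal polynomial.** [folklore] -/
theorem card_filter_minpoly_eq (E : IntermediateField M ℂ) {g : M[X]} (hg : g ≠ 0) {y : ℂ} (hy : y ∈ (g.aroots ℂ).toFinset) :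
    ((g.aroots ℂ).toFinset.filter (fun y' => minpoly E y' = minpoly E y)).card = (minpoly E y).natDegree := by
  have hyint : IsIntegral E y := isIntegral_of_mem_aroots_toFinset E hg hy
  haveI : CharZero E := (algebraMap E ℂ).charZero
  rw [filter_minpoly_eq_eq_aroots E hg hy, card_aroots_toFinset_eq_natDegree (PerfectField.separable_of_irreducible (minpoly.irreducible hyint))]

/-- The degree of the minimal polynomial over `E` of a root of `g` is at most the number of complex roots of `g`. [folklore] -/
theorem natDegree_minpoly_le_card (E : IntermediateField M ℂ) {g : M[X]} (hg : g ≠ 0) {y : ℂ} (hy : y ∈ (g.aroots ℂ).toFinset) :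
    (minpoly E y).natDegree ≤ (g.aroots ℂ).toFinset.card := by
  rw [← card_filter_minpoly_eq E hg hy]
  exact Finset.card_filter_le _ _

/-- **Degree `1` means membership.** [folklore] -/
theorem mem_of_natDegree_minpoly_eq_one (E : IntermediateField M ℂ) {y : ℂ} (h : (minpoly E y).natDegree = 1) : y ∈ E := by
  obtain ⟨z, hz⟩ := minpoly.natDegree_eq_one_iff.1 h
  rw [← hz]
  exact z.2


/-- **A class of full size.**  If one root of `g` (with `5`… or any number of complex roots) has minimal polynomial over `E` of degree equal to the number of
roots of `g`, then so does every root of `g`: the class of that root is the whole root set. [folklore] -/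
theorem natDegree_minpoly_eq_card_of_one (E : IntermediateField M ℂ) {g : M[X]} (hg : g ≠ 0) {y₀ : ℂ} (hy₀ : y₀ ∈ (g.aroots ℂ).toFinset)
    (h : (minpoly E y₀).natDegree = (g.aroots ℂ).toFinset.card) {y : ℂ} (hy : y ∈ (g.aroots ℂ).toFinset) :
    (minpoly E y).natDegree = (g.aroots ℂ).toFinset.card := by
  have hC : (g.aroots ℂ).toFinset.filter (fun y' => minpoly E y' = minpoly E y₀) = (g.aroots ℂ).toFinset :=
    Finset.eq_of_subset_of_card_le (Finset.filter_subset _ _) (by rw [card_filter_minpoly_eq E hg hy₀, h])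
  have hy' : y ∈ (g.aroots ℂ).toFinset.filter (fun y' => minpoly E y' = minpoly E y₀) := by rw [hC]; exact hy
  rw [(Finset.mem_filter.1 hy').2, h]

/-- **No class of size `|roots| − 1`.**  If no root of `g` lies in `E` (no class of size `1`), then no class has exactly one root fewer than all of them.
[folklore] -/
theorem natDegree_minpoly_ne_card_sub_one (E : IntermediateField M ℂ) {g : M[X]} (hg : g ≠ 0) (h2 : 2 ≤ (g.aroots ℂ).toFinset.card)
    (h1 : ∀ y ∈ (g.aroots ℂ).toFinset, (minpoly E y).natDegree ≠ 1) {y : ℂ} (hy : y ∈ (g.aroots ℂ).toFinset) :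
    (minpoly E y).natDegree ≠ (g.aroots ℂ).toFinset.card - 1 := by
  intro h
  set Y := (g.aroots ℂ).toFinset with hYdef
  set C := Y.filter (fun y' => minpoly E y' = minpoly E y) with hCdef
  have hCcard : C.card = Y.card - 1 := by rw [hCdef, card_filter_minpoly_eq E hg hy, h]
  have hT : (Y \ C).card = 1 := by
    rw [Finset.card_sdiff_of_subset (Finset.filter_subset _ _), hCcard]
    omega
  obtain ⟨y'', hy''⟩ := Finset.card_eq_one.1 hT
  have hy''T : y'' ∈ Y \ C := by rw [hy'']; exact Finset.mem_singleton_self _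
  have hy''Y : y'' ∈ Y := (Finset.mem_sdiff.1 hy''T).1
  -- the class of `y''` lies inside `Y \ C`, a singleton
  have hsub : Y.filter (fun y' => minpoly E y' = minpoly E y'') ⊆ Y \ C := by
    intro z hz
    obtain ⟨hzY, hzmin⟩ := Finset.mem_filter.1 hz
    refine Finset.mem_sdiff.2 ⟨hzY, fun hzC => (Finset.mem_sdiff.1 hy''T).2 ?_⟩
    exact Finset.mem_filter.2 ⟨hy''Y, by rw [← hzmin]; exact (Finset.mem_filter.1 hzC).2⟩
  have hle : (minpoly E y'').natDegree ≤ 1 := by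
    rw [← card_filter_minpoly_eq E hg hy''Y, ← hT]
    exact Finset.card_le_card hsub
  have hpos : 0 < (minpoly E y'').natDegree := minpoly.natDegree_pos (isIntegral_of_mem_aroots_toFinset E hg hy''Y)
  exact h1 y'' hy''Y (by omega)

/-- **Counting a degree class.**  If every root of `g` has minimal polynomial over `E` of degree `2` or `3`, the roots of degree `2` come in classes of
size `2` and those of degree `3` in classes of size `3`; with `5` roots in all, exactly `2` of them have degree `2`. [folklore] -/
theorem card_filter_natDegree_eq_two (E : IntermediateField M ℂ) {g : M[X]} (hg : g ≠ 0) (h5 : (g.aroots ℂ).toFinset.card = 5)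
    (h23 : ∀ y ∈ (g.aroots ℂ).toFinset, (minpoly E y).natDegree = 2 ∨ (minpoly E y).natDegree = 3) :
    ((g.aroots ℂ).toFinset.filter (fun y => (minpoly E y).natDegree = 2)).card = 2 := by
  set Y := (g.aroots ℂ).toFinset with hYdef
  -- a degree class is a union of minimal-polynomial classes of that size
  have hdiv : ∀ c : ℕ, (Y.filter (fun y => (minpoly E y).natDegree = c)).card =
      ((Y.filter (fun y => (minpoly E y).natDegree = c)).image (fun y => minpoly E y)).card * c := by
    intro c
    rw [Finset.card_eq_sum_card_image (fun y => minpoly E y) (Y.filter (fun y => (minpoly E y).natDegree = c))]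
    refine Finset.sum_const_nat fun q hq => ?_
    obtain ⟨y₀, hy₀, rfl⟩ := Finset.mem_image.1 hq
    obtain ⟨hy₀Y, hy₀c⟩ := Finset.mem_filter.1 hy₀
    have heq : (Y.filter (fun y => (minpoly E y).natDegree = c)).filter (fun y => minpoly E y = minpoly E y₀) =
        Y.filter (fun y' => minpoly E y' = minpoly E y₀) := by
      ext z
      simp only [Finset.mem_filter]
      constructor
      · rintro ⟨⟨hz, -⟩, h⟩
        exact ⟨hz, h⟩
      · rintro ⟨hz, h⟩
        exact ⟨⟨hz, by rw [h, hy₀c]⟩, h⟩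
    rw [heq, card_filter_minpoly_eq E hg hy₀Y, hy₀c]
  have h2 := hdiv 2
  have h3 := hdiv 3
  have hsum := Finset.card_filter_add_card_filter_not (s := Y) (fun y => (minpoly E y).natDegree = 2)
  have hneg : Y.filter (fun y => ¬ (minpoly E y).natDegree = 2) = Y.filter (fun y => (minpoly E y).natDegree = 3) := by
    refine Finset.filter_congr fun y hy => ?_
    rcases h23 y hy with h | h <;> rw [h] <;> norm_num
  rw [hneg, h5] at hsum
  omega

/-- **A quadratic class lives in one quadratic extension.**  If `y₁` has the same minimal polynomial over `E` as `y₀`, of degree `2`, then `y₁ ∈ E(y₀)`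
(`y₁ = y₀` or `y₁ = −y₀ − (the middle coefficient)`). [folklore] -/
theorem mem_adjoin_of_minpoly_eq_of_natDegree_eq_two (E : IntermediateField M ℂ) {y₀ y₁ : ℂ} (hy₀ : IsIntegral E y₀)
    (hmin : minpoly E y₁ = minpoly E y₀) (h2 : (minpoly E y₀).natDegree = 2) : y₁ ∈ E⟮y₀⟯ := by
  set q := minpoly E y₀ with hq
  have hev : ∀ y : ℂ, aeval y q = algebraMap E ℂ (q.coeff 0) + algebraMap E ℂ (q.coeff 1) * y + y ^ 2 := by
    intro y
    rw [aeval_eq_sum_range, h2]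
    simp only [Finset.sum_range_succ, Finset.sum_range_zero, zero_add, pow_zero, pow_one, Algebra.smul_def, mul_one]
    have hlead : q.coeff 2 = 1 := by
      have := (minpoly.monic hy₀).coeff_natDegree
      rwa [h2] at this
    rw [hlead, map_one, one_mul]
  have h0 : aeval y₀ q = 0 := minpoly.aeval E y₀
  have h1 : aeval y₁ q = 0 := by rw [← hmin]; exact minpoly.aeval E y₁
  rw [hev] at h0 h1
  have hprod : (y₁ - y₀) * (y₁ + y₀ + algebraMap E ℂ (q.coeff 1)) = 0 := by
    have := sub_eq_zero.2 (h1.trans h0.symm)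
    rw [← this]
    ring
  rcases mul_eq_zero.1 hprod with h | h
  · rw [sub_eq_zero.1 h]
    exact mem_adjoin_simple_self E y₀
  · have : y₁ = -(y₀ + algebraMap E ℂ (q.coeff 1)) := by
      rw [eq_neg_iff_add_eq_zero, ← h]
      ring
    rw [this]
    exact neg_mem (add_mem (mem_adjoin_simple_self E y₀) (E⟮y₀⟯.algebraMap_mem (q.coeff 1)))

end OneSide

/-! ## §2 Two simple extensions: the tower law, symmetry of the relative degree, and the degree chase -/

section TwoSides

variable {M : Type*} [Field M] [Algebra M ℂ]

/-- **Tower law for `M ⊂ M(x) ⊂ M(x, y)`.** [folklore] -/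
theorem finrank_adjoin_pair_eq_mul (x : ℂ) {y : ℂ} (hy : IsIntegral M y) :
    Module.finrank M ↥M⟮x, y⟯ = Module.finrank M ↥M⟮x⟯ * (minpoly M⟮x⟯ y).natDegree := by
  rw [← adjoin.finrank hy.tower_top, Module.finrank_mul_finrank M ↥M⟮x⟯ ↥(M⟮x⟯⟮y⟯)]
  have h : (M⟮x⟯⟮y⟯).restrictScalars M = M⟮x, y⟯ := adjoin_simple_adjoin_simple M x y
  rw [← h]
  rfl

/-- **Symmetry of the relative degree.**  If `[M(x) : M] = [M(y) : M]` then `[M(x)(y) : M(x)] = [M(y)(x) : M(y)]`. [folklore] -/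
theorem natDegree_minpoly_adjoin_symm {x y : ℂ} (hx : IsIntegral M x) (hy : IsIntegral M y)
    (h : Module.finrank M ↥M⟮x⟯ = Module.finrank M ↥M⟮y⟯) : (minpoly M⟮x⟯ y).natDegree = (minpoly M⟮y⟯ x).natDegree := by
  have h1 := finrank_adjoin_pair_eq_mul (M := M) x hy
  have h2 := finrank_adjoin_pair_eq_mul (M := M) y hx
  have hxy : M⟮x, y⟯ = M⟮y, x⟯ := by rw [Set.pair_comm]
  rw [hxy, h2, h] at h1
  haveI : FiniteDimensional M ↥M⟮y⟯ := adjoin.finiteDimensional hy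
  exact (Nat.eq_of_mul_eq_mul_left Module.finrank_pos h1).symm

/-- **A conjugate of `a` is integral with the same minimal polynomial.** [folklore] -/
theorem minpoly_eq_of_aeval_minpoly_eq_zero {a x : ℂ} (ha : IsIntegral M a) (hx : aeval x (minpoly M a) = 0) : minpoly M x = minpoly M a :=
  (minpoly.eq_of_irreducible_of_monic (minpoly.irreducible ha) hx (minpoly.monic ha)).symm

/-- **Transport of a root to `M(a)`.**  If a root `y` of `g ∈ M[X]` lies in `M(x)` for some conjugate `x` of `a` over `M`, then some root of `g` lies in
`M(a)` (apply the `M`-embedding `M(x) → ℂ`, `x ↦ a`). [cite: Lang2002, V §2 Thm. 2.8] -/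
theorem exists_root_mem_adjoin_of_root_mem_adjoin_conj {a x y : ℂ} (ha : IsIntegral M a) (hx : aeval x (minpoly M a) = 0) {g : M[X]}
    (hy : aeval y g = 0) (hyx : y ∈ M⟮x⟯) : ∃ y' : ℂ, aeval y' g = 0 ∧ y' ∈ M⟮a⟯ := by
  have hmin : minpoly M x = minpoly M a := minpoly_eq_of_aeval_minpoly_eq_zero ha hx
  have hxint : IsIntegral M x := by
    refine isAlgebraic_iff_isIntegral.mp ⟨minpoly M a, minpoly.ne_zero ha, hx⟩
  have hamem : a ∈ (minpoly M x).aroots ℂ := by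
    rw [mem_aroots, hmin]
    exact ⟨minpoly.ne_zero ha, minpoly.aeval M a⟩
  let φ : ↥M⟮x⟯ →ₐ[M] ℂ := (algHomAdjoinIntegralEquiv M hxint).symm ⟨a, hamem⟩
  have hφ : φ (AdjoinSimple.gen M x) = a := algHomAdjoinIntegralEquiv_symm_apply_gen M hxint ⟨a, hamem⟩
  let z : ↥M⟮x⟯ := ⟨y, hyx⟩
  refine ⟨φ z, ?_, ?_⟩
  · have hz : aeval z g = 0 := by
      have h1 : ((aeval z g : ↥M⟮x⟯) : ℂ) = 0 := by rw [← aeval_coe]; exact hy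
      exact_mod_cast h1
    rw [aeval_algHom_apply, hz, map_zero]
  · obtain ⟨q, hq⟩ := (adjoin.powerBasis hxint).exists_eq_aeval' z
    rw [hq, adjoin.powerBasis_gen, ← aeval_algHom_apply, hφ]
    exact algebra_adjoin_le_adjoin M _ (aeval_mem_adjoin_singleton M a)

/-- **THE QUINTIC DEGREE CHASE.**  Let `a, b ∈ ℂ` have degree `5` over a subfield `M`, and suppose that for every conjugate `x` of `a` and every conjugate
`y` of `b` over `M`, `y ∉ M(x)` (no conjugate of `b` is of degree `1` over any `M(x)`).  Then `[M(a, b) : M] = 25`, i.e. the minimal polynomial of `b`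
stays irreducible over `M(a)`.  ELEMENTARY PROOF (no classification of transitive quintic groups): put `d(x,y) = [M(x)(y) : M(x)]`, the size of the class of
`y` over `M(x)`; `d` is symmetric (tower law, both `[M(x):M] = [M(y):M] = 5`), `d ≠ 1` (hypothesis), `d ≠ 4` (the complementary class would have size
`1`); if `d = 5` somewhere it is `5` everywhere (full classes on both sides) and we are done.  Otherwise `d ∈ {2, 3}` throughout, every `x` has exactly two
`y` with `d(x,y) = 2` and vice versa; for such an edge `(x₀, y₀)` the quadratic classes `{y₀, y₁}` over `M(x₀)` and `{x₀, x₁}` over `M(y₀)` lie in the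
field `M(x₀, y₀)` of degree `10`, so `M(x₁, y₁) ⊆ M(x₀, y₀)` forces `5 d(x₁,y₁) ∣ 10`, `d(x₁, y₁) = 2`: the rows of `x₀` and `x₁` coincide, the fibres of
`x ↦ row(x)` are the `2`-element columns, and `5 = |conjugates of a|` would be even. [cite: Lang2002, V §1 Prop. 1.2, VI §1 Thm. 1.1] -/
theorem finrank_adjoin_pair_eq_of_forall_not_mem {a b : ℂ} (ha : IsIntegral M a) (hb : IsIntegral M b) (h5a : (minpoly M a).natDegree = 5)
    (h5b : (minpoly M b).natDegree = 5) (H : ∀ x y : ℂ, aeval x (minpoly M a) = 0 → aeval y (minpoly M b) = 0 → y ∉ M⟮x⟯) :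
    Module.finrank M ↥M⟮a, b⟯ = 25 := by
  haveI : CharZero M := (algebraMap M ℂ).charZero
  set f := minpoly M a with hfdef
  set g := minpoly M b with hgdef
  have hf0 : f ≠ 0 := minpoly.ne_zero ha
  have hg0 : g ≠ 0 := minpoly.ne_zero hb
  set X := (f.aroots ℂ).toFinset with hXdef
  set Y := (g.aroots ℂ).toFinset with hYdef
  have hXcard : X.card = 5 := by rw [hXdef, card_aroots_toFinset_eq_natDegree (PerfectField.separable_of_irreducible (minpoly.irreducible ha)), h5a]
  have hYcard : Y.card = 5 := by rw [hYdef, card_aroots_toFinset_eq_natDegree (PerfectField.separable_of_irreducible (minpoly.irreducible hb)), h5b]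
  have haX : a ∈ X := (mem_aroots_toFinset_iff hf0).2 (minpoly.aeval M a)
  have hbY : b ∈ Y := (mem_aroots_toFinset_iff hg0).2 (minpoly.aeval M b)
  -- conjugates: integral, same minimal polynomial, degree `5`
  have hXint : ∀ x ∈ X, IsIntegral M x := fun x hx => isAlgebraic_iff_isIntegral.mp ⟨f, hf0, (mem_aroots_toFinset_iff hf0).1 hx⟩
  have hYint : ∀ y ∈ Y, IsIntegral M y := fun y hy => isAlgebraic_iff_isIntegral.mp ⟨g, hg0, (mem_aroots_toFinset_iff hg0).1 hy⟩
  have hXfin : ∀ x ∈ X, Module.finrank M ↥M⟮x⟯ = 5 := fun x hx => by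
    rw [adjoin.finrank (hXint x hx), minpoly_eq_of_aeval_minpoly_eq_zero ha ((mem_aroots_toFinset_iff hf0).1 hx), ← hfdef, h5a]
  have hYfin : ∀ y ∈ Y, Module.finrank M ↥M⟮y⟯ = 5 := fun y hy => by
    rw [adjoin.finrank (hYint y hy), minpoly_eq_of_aeval_minpoly_eq_zero hb ((mem_aroots_toFinset_iff hg0).1 hy), ← hgdef, h5b]
  -- the relative degree is symmetric
  have hsymm : ∀ x ∈ X, ∀ y ∈ Y, (minpoly M⟮x⟯ y).natDegree = (minpoly M⟮y⟯ x).natDegree := fun x hx y hy =>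
    natDegree_minpoly_adjoin_symm (hXint x hx) (hYint y hy) (by rw [hXfin x hx, hYfin y hy])
  -- no class of size `1` (hypothesis), on either side
  have hne1 : ∀ x ∈ X, ∀ y ∈ Y, (minpoly M⟮x⟯ y).natDegree ≠ 1 := fun x hx y hy h1 =>
    H x y ((mem_aroots_toFinset_iff hf0).1 hx) ((mem_aroots_toFinset_iff hg0).1 hy) (mem_of_natDegree_minpoly_eq_one _ h1)
  have hne1' : ∀ y ∈ Y, ∀ x ∈ X, (minpoly M⟮y⟯ x).natDegree ≠ 1 := fun y hy x hx => by rw [← hsymm x hx y hy]; exact hne1 x hx y hy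
  -- it suffices to find ONE full class
  suffices key : ∃ x ∈ X, ∃ y ∈ Y, (minpoly M⟮x⟯ y).natDegree = 5 by
    obtain ⟨x, hx, y, hy, hxy⟩ := key
    have h1 : (minpoly M⟮x⟯ b).natDegree = 5 := by
      have := natDegree_minpoly_eq_card_of_one M⟮x⟯ hg0 hy (by rw [hxy, ← hYdef, hYcard]) hbY
      rwa [← hYdef, hYcard] at this
    have h2 : (minpoly M⟮b⟯ x).natDegree = 5 := by rwa [hsymm x hx b hbY] at h1
    have h3 : (minpoly M⟮b⟯ a).natDegree = 5 := by
      have := natDegree_minpoly_eq_card_of_one M⟮b⟯ hf0 hx (by rw [h2, ← hXdef, hXcard]) haX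
      rwa [← hXdef, hXcard] at this
    have h4 : (minpoly M⟮a⟯ b).natDegree = 5 := by rwa [← hsymm a haX b hbY] at h3
    rw [finrank_adjoin_pair_eq_mul a hb, hXfin a haX, h4]
  -- suppose not: every relative degree is `2` or `3`
  by_contra hkey
  push Not at hkey
  have h23 : ∀ x ∈ X, ∀ y ∈ Y, (minpoly M⟮x⟯ y).natDegree = 2 ∨ (minpoly M⟮x⟯ y).natDegree = 3 := by
    intro x hx y hy
    have h4 : (minpoly M⟮x⟯ y).natDegree ≠ Y.card - 1 := natDegree_minpoly_ne_card_sub_one M⟮x⟯ hg0 (by rw [hYcard]; norm_num) (hne1 x hx) hy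
    have hle : (minpoly M⟮x⟯ y).natDegree ≤ Y.card := natDegree_minpoly_le_card M⟮x⟯ hg0 hy
    have hpos : 0 < (minpoly M⟮x⟯ y).natDegree := minpoly.natDegree_pos (hYint y hy).tower_top
    have h1 := hne1 x hx y hy
    have h5 := hkey x hx y hy
    rw [hYcard] at h4 hle
    omega
  have h23' : ∀ y ∈ Y, ∀ x ∈ X, (minpoly M⟮y⟯ x).natDegree = 2 ∨ (minpoly M⟮y⟯ x).natDegree = 3 := fun y hy x hx => by
    rw [← hsymm x hx y hy]; exact h23 x hx y hy
  -- rows and columns of the «degree 2» relation have exactly two entries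
  set row : ℂ → Finset ℂ := fun x => Y.filter (fun y => (minpoly M⟮x⟯ y).natDegree = 2) with hrowdef
  set col : ℂ → Finset ℂ := fun y => X.filter (fun x => (minpoly M⟮y⟯ x).natDegree = 2) with hcoldef
  have hrow : ∀ x ∈ X, (row x).card = 2 := fun x hx => card_filter_natDegree_eq_two M⟮x⟯ hg0 hYcard (h23 x hx)
  have hcol : ∀ y ∈ Y, (col y).card = 2 := fun y hy => card_filter_natDegree_eq_two M⟮y⟯ hf0 hXcard (h23' y hy)
  -- THE CHASE: an edge `(x₀, y₀)`, `x₁` in the column of `y₀`, `y₁` in the row of `x₀` ⟹ `(x₁, y₁)` is an edge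
  have hchase : ∀ x₀ ∈ X, ∀ y₀ ∈ row x₀, ∀ x₁ ∈ col y₀, ∀ y₁ ∈ row x₀, (minpoly M⟮x₁⟯ y₁).natDegree = 2 := by
    intro x₀ hx₀ y₀ hy₀ x₁ hx₁ y₁ hy₁
    obtain ⟨hy₀Y, hd₀₀⟩ := Finset.mem_filter.1 hy₀
    obtain ⟨hx₁X, he₀₁⟩ := Finset.mem_filter.1 hx₁
    obtain ⟨hy₁Y, hd₀₁⟩ := Finset.mem_filter.1 hy₁
    -- `y₁` is in the class of `y₀` over `M(x₀)`, hence in `M(x₀, y₀)`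
    have hCy : Y.filter (fun y' => minpoly M⟮x₀⟯ y' = minpoly M⟮x₀⟯ y₀) = row x₀ := by
      refine Finset.eq_of_subset_of_card_le (fun z hz => ?_) (by rw [hrow x₀ hx₀, card_filter_minpoly_eq M⟮x₀⟯ hg0 hy₀Y, hd₀₀])
      obtain ⟨hzY, hzmin⟩ := Finset.mem_filter.1 hz
      exact Finset.mem_filter.2 ⟨hzY, by rw [hzmin, hd₀₀]⟩
    have hy₁C : y₁ ∈ Y.filter (fun y' => minpoly M⟮x₀⟯ y' = minpoly M⟮x₀⟯ y₀) := by rw [hCy]; exact hy₁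
    have hy₁F : y₁ ∈ M⟮x₀, y₀⟯ := by
      have h := mem_adjoin_of_minpoly_eq_of_natDegree_eq_two M⟮x₀⟯ (hYint y₀ hy₀Y).tower_top (Finset.mem_filter.1 hy₁C).2 hd₀₀
      rw [← adjoin_simple_adjoin_simple, mem_restrictScalars]
      exact h
    -- `x₁` is in the class of `x₀` over `M(y₀)`, hence in `M(y₀, x₀) = M(x₀, y₀)`
    have he₀₀ : (minpoly M⟮y₀⟯ x₀).natDegree = 2 := by rw [← hsymm x₀ hx₀ y₀ hy₀Y]; exact hd₀₀
    have hCx : X.filter (fun x' => minpoly M⟮y₀⟯ x' = minpoly M⟮y₀⟯ x₀) = col y₀ := by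
      refine Finset.eq_of_subset_of_card_le (fun z hz => ?_) (by rw [hcol y₀ hy₀Y, card_filter_minpoly_eq M⟮y₀⟯ hf0 hx₀, he₀₀])
      obtain ⟨hzX, hzmin⟩ := Finset.mem_filter.1 hz
      exact Finset.mem_filter.2 ⟨hzX, by rw [hzmin, he₀₀]⟩
    have hx₁C : x₁ ∈ X.filter (fun x' => minpoly M⟮y₀⟯ x' = minpoly M⟮y₀⟯ x₀) := by rw [hCx]; exact hx₁
    have hx₁F : x₁ ∈ M⟮x₀, y₀⟯ := by
      have h := mem_adjoin_of_minpoly_eq_of_natDegree_eq_two M⟮y₀⟯ (hXint x₀ hx₀).tower_top (Finset.mem_filter.1 hx₁C).2 he₀₀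
      rw [Set.pair_comm, ← adjoin_simple_adjoin_simple, mem_restrictScalars]
      exact h
    -- hence `M(x₁, y₁) ⊆ M(x₀, y₀)`, of degree `10`: `5 · d(x₁, y₁) ∣ 10`
    have hle : M⟮x₁, y₁⟯ ≤ M⟮x₀, y₀⟯ := adjoin_le_iff.2 (Set.insert_subset hx₁F (Set.singleton_subset_iff.2 hy₁F))
    have hdvd := finrank_dvd_of_le_right hle
    rw [finrank_adjoin_pair_eq_mul x₁ (hYint y₁ hy₁Y), finrank_adjoin_pair_eq_mul x₀ (hYint y₀ hy₀Y), hXfin x₁ hx₁X, hXfin x₀ hx₀, hd₀₀] at hdvd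
    have hd : (minpoly M⟮x₁⟯ y₁).natDegree ∣ 2 := (Nat.mul_dvd_mul_iff_left (by norm_num : 0 < 5)).1 hdvd
    rcases h23 x₁ hx₁X y₁ hy₁Y with h | h
    · exact h
    · rw [h] at hd
      exact absurd (Nat.le_of_dvd (by norm_num) hd) (by norm_num)
  -- consequently the rows of `x₀` and of any `x₁` in the column of an entry of that row coincide
  have hroweq : ∀ x₀ ∈ X, ∀ y₀ ∈ row x₀, ∀ x₁ ∈ col y₀, row x₁ = row x₀ := by
    intro x₀ hx₀ y₀ hy₀ x₁ hx₁
    symm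
    refine Finset.eq_of_subset_of_card_le (fun y₁ hy₁ => ?_) (by rw [hrow x₁ (Finset.mem_filter.1 hx₁).1, hrow x₀ hx₀])
    exact Finset.mem_filter.2 ⟨(Finset.mem_filter.1 hy₁).1, hchase x₀ hx₀ y₀ hy₀ x₁ hx₁ y₁ hy₁⟩
  -- the fibres of `x ↦ row x` on `X` are columns, of size `2`: `|X| = 5` would be even
  have hfib : ∀ x₀ ∈ X, (X.filter (fun x => row x = row x₀)).card = 2 := by
    intro x₀ hx₀
    obtain ⟨y₀, hy₀⟩ : (row x₀).Nonempty := by rw [← Finset.card_pos, hrow x₀ hx₀]; norm_num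
    have hfc : X.filter (fun x => row x = row x₀) = col y₀ := by
      ext x
      constructor
      · intro hx
        obtain ⟨hxX, hr⟩ := Finset.mem_filter.1 hx
        have hy₀' : y₀ ∈ row x := by rw [hr]; exact hy₀
        obtain ⟨hy₀Y, hd⟩ := Finset.mem_filter.1 hy₀'
        exact Finset.mem_filter.2 ⟨hxX, by rw [← hsymm x hxX y₀ hy₀Y]; exact hd⟩
      · intro hx
        exact Finset.mem_filter.2 ⟨(Finset.mem_filter.1 hx).1, hroweq x₀ hx₀ y₀ hy₀ x hx⟩
    rw [hfc, hcol y₀ (Finset.mem_filter.1 hy₀).1]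
  have hsum := Finset.card_eq_sum_card_image row X
  rw [Finset.sum_const_nat (m := 2) (fun r hr => by obtain ⟨x₀, hx₀, rfl⟩ := Finset.mem_image.1 hr; exact hfib x₀ hx₀), hXcard] at hsum
  omega

end TwoSides

end Summit.HodgeConjecture.CorCM.MultiFieldWeil

end
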